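import Summits.ResolutionOfSingularities.ResolutionOfSingularities.Theorems.EquisingularLiftEquisingularLiftNatTowerRationalDefs

/-!
# idea-3 `generic-germ-clock` (round 2) — the typed deliverable `DirStepSec ↦ DirStepRatFinite` and its admissibility lemma (tooth (3)+(2))

res-L1-w45b-idea-3 g2 (crux-ideate on stmt-ResolutionOfSingularities-20148). OURS, planning vocabulary only; AI-written, weaker than expert
review; no summit statement is proved here. Rows R5/R6/R9 of the card's existence statement C⁺_∃: the direction curve `Γ` of a round need not be a
SECTION of the running ruled surface over the carrier — a regular RATIONAL MULTISECTION finite flat over the carrier (separable, radicial or mixed)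
is served by the same engine (T-P1VB on `Γ̃ ≅ ℙ¹`, `EmbeddedLiftFact`). The admissibility lemma says that at the BIRTH of the ruled surface
`E = υ'⁻¹ Z₉` over a RATIONAL carrier every irreducible regular rational multisection of degree ≥ 2 is `DirStepUnobs` (`Γ² ≥ 0` on `F_n`, Hartshorne
V.2.20 — characteristic-free BECAUSE `e = n ≥ 0`; over carriers of genus ≥ 1 in characteristic `p` Frobenius-destabilised bundles give radicial
multisections of negative square, so the rational-carrier hypothesis is load-bearing, not cosmetic).
-/

noncomputable section

open CategoryTheory AlgebraicGeometry TopologicalSpace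
open Literature.AlgebraicGeometry.Resolution (IsBlowup)

namespace Summit.ResolutionOfSingularities.ResolutionOfSingularities.Cruxes.EquisingularLiftNat.Sections

/-- **DIRSTEP / (ratfin)** — idea-3 `generic-germ-clock` rows R5/R6/R9: «`Γ` is a regular-or-not, RATIONAL MULTISECTION of the ruled surface over the
carrier curve»: the reduced `Γ̃ ⊆ G` maps FINITELY, FLATLY and SURJECTIVELY onto the reduced carrier `Z̃₉ ⊆ F₉` under `G → F₁₀ → F₉` (degree ≥ 1; an
isomorphism = `DirStepSec`; purely inseparable = the radicial row R6), and `Γ̃ ≅ ℙ¹_{k'}` (`RationalCarrier`). Downstairs only. -/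
def DirStepRatFinite (F₉ F₁₀ : Scheme.{0}) (υ' : F₁₀ ⟶ F₉) (Z₉ : Set F₉) (hZ₉ : IsClosed Z₉)
    (G : Scheme.{0}) (γ : G ⟶ F₁₀) (Γ : Set G) (hΓ : IsClosed Γ) : Prop :=
  ∃ δ : redSub G Γ hΓ ⟶ redSub F₉ Z₉ hZ₉, δ ≫ redSubι F₉ Z₉ hZ₉ = redSubι G Γ hΓ ≫ γ ≫ υ' ∧
    IsFinite δ ∧ Flat δ ∧ Surjective δ ∧ RationalCarrier (redSub G Γ hΓ)

/-- Sanity: on a rational carrier the old clause is the degree-1 case of the new one. -/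
theorem dirStepRatFinite_of_dirStepSec (F₉ F₁₀ : Scheme.{0}) (υ' : F₁₀ ⟶ F₉) (Z₉ : Set F₉) (hZ₉ : IsClosed Z₉)
    (G : Scheme.{0}) (γ : G ⟶ F₁₀) (Γ : Set G) (hΓ : IsClosed Γ)
    (hsec : DirStepSec F₉ F₁₀ υ' Z₉ hZ₉ G γ Γ hΓ) (hrat : RationalCarrier (redSub F₉ Z₉ hZ₉)) :
    DirStepRatFinite F₉ F₁₀ υ' Z₉ hZ₉ G γ Γ hΓ := by
  obtain ⟨δ, hδ, hiso⟩ := hsec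
  obtain ⟨k', _, ⟨e⟩⟩ := hrat
  refine ⟨δ, hδ, inferInstance, inferInstance, inferInstance, ⟨k', inferInstance, ⟨asIso δ ≪≫ e⟩⟩⟩

/-- **ADMISSIBILITY STUB (tooth (3)+(2) of the card; the ORDER clause is the hypothesis «at the seed stage»).** At the SEED of a direction step —
`υ' : F₁₀ ⟶ F₉` the blow-up of the regular RATIONAL carrier curve `Z₉` in the ambient `F₉` regular and `3`-dimensional along `Z₉`, running ruled
surface `E = υ'⁻¹ Z₉` (geometrically ruled over `Z̃₉ ≅ ℙ¹`, no point step on it yet) — every irreducible closed `Γ ⊆ E` whose reduced structure is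
regular, rational and finite flat surjective over `Z̃₉` but NOT a section has unobstructed embedded deformations in `E` (`Γ·Γ ≥ 0 ⇒ H¹(Γ̃, 𝒩_{Γ̃/Ẽ}) = 0`).
Size guess M–L (intersection numerics on `F_n` in the tree's Čech vocabulary). Not proved here. -/
theorem stub_dirStepUnobs_of_ratFinite_seed (F₉ F₁₀ : Scheme.{0}) (υ' : F₁₀ ⟶ F₉) (Z₉ : Set F₉) (hZ₉ : IsClosed Z₉)
    (hbl : IsBlowup υ' (Scheme.IdealSheafData.vanishingIdeal (⟨Z₉, hZ₉⟩ : Closeds F₉)))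
    (hZrat : RationalCarrier (redSub F₉ Z₉ hZ₉))
    (hZreg : ∀ z : redSub F₉ Z₉ hZ₉, IsRegularLocalRing ((redSub F₉ Z₉ hZ₉).presheaf.stalk z))
    (hFreg : ∀ z : redSub F₉ Z₉ hZ₉, IsRegularLocalRing (F₉.presheaf.stalk (redSubι F₉ Z₉ hZ₉ z)))
    (hF3 : ∀ z : redSub F₉ Z₉ hZ₉, IsClosed ({redSubι F₉ Z₉ hZ₉ z} : Set F₉) →
      ringKrullDim (F₉.presheaf.stalk (redSubι F₉ Z₉ hZ₉ z)) = 3)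
    (Γ : Set F₁₀) (hΓ : IsClosed Γ) (hΓE : Γ ⊆ υ' ⁻¹' Z₉) (hirr : IsIrreducible Γ)
    (hΓreg : ∀ x : redSub F₁₀ Γ hΓ, IsRegularLocalRing ((redSub F₁₀ Γ hΓ).presheaf.stalk x))
    (hrat : DirStepRatFinite F₉ F₁₀ υ' Z₉ hZ₉ F₁₀ (𝟙 F₁₀) Γ hΓ)
    (hnotsec : ¬ DirStepSec F₉ F₁₀ υ' Z₉ hZ₉ F₁₀ (𝟙 F₁₀) Γ hΓ) :
    DirStepUnobs F₁₀ (υ' ⁻¹' Z₉) (hZ₉.preimage υ'.base.hom.continuous) Γ hΓ := by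
  sorry

end Summit.ResolutionOfSingularities.ResolutionOfSingularities.Cruxes.EquisingularLiftNat.Sections

end
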